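import Summits.BirchSwinnertonDyer.BirchSwinnertonDyer.Theorems.ResidualThetaTransportAtTwoThetaLayerLambdaCongruenceAtTwoDualChainAcyclic
import HarnessLib

/-!
# Crux `ThetaLayerLambdaCongruenceAtTwo` (stmt-BirchSwinnertonDyer-20688, route ResidualThetaTransportAtTwo), line
# `birth` v14 — SD floor, kernel road, Hecke clause of IP, brick HA2 «FLAG SIDE FUNCTION»: the side of the generic flag
# `C·(∞, ½⁺ + i∞)` with respect to the Farey edge `{∞, 0}`, for ALL integer matrices `C` of positive determinant; it extends w2's
# triangle side function `G₁` from `SL₂(ℤ)`, is never degenerate, flips under edge reversal, and every flag lies in a Farey triangle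
# («anchor») (width seat bsd-wall-rtt-p3-w3 g11; `--supports stmt-BirchSwinnertonDyer-20688 --as helper`; closes nothing)

HONEST FRAMING. Elementary THEOREMS about `2×2` integer matrices; no definition (the side functions are written out as `if … then 1 else 0`
expressions, as in `…DualChainAcyclic`); nothing about any curve or form is asserted; BSD is not proved by any of this.

WHY (memo `Cruxes/ThetaLayerLambdaCongruenceAtTwo/Lines/birth-sd2-hecke-adjoint.md`, step (B)). Hecke correspondences move the Farey
tessellation by integer matrices `M` of determinant `p`; the image `M·z₀` of an honest base point falls ON Farey edges (already for `T_2`).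
The remedy is a GENERIC base point: the flag `φ₀ = (∞, x₀⁺)`, i.e. the point `x₀ + iK` with `K → ∞` and `x₀ = ½ + 0⁺`, inside the base
triangle `{∞, 0, 1}`. For `C = (a b; c d)`, `det C > 0`, the sign of `Re(C·z₀)·|cz₀ + d|² = ac(x₀² + K²) + (ad + bc)x₀ + bd` in the regime
`K ≫ 1 ≫ (x₀ − ½) > 0` is the LEXICOGRAPHIC sign of `(ac, (a+2b)(c+2d), ad+bc)`; so
  `F(C) := [lex(ac, (a+2b)(c+2d), ad+bc) > 0] ∈ {0, 1}`
is «the flag `C·φ₀` lies on the positive side of the edge `{∞, 0}`» (the side of the base triangle). THEOREMS: (B1) `F = G₁` on `SL₂(ℤ)`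
(`flagSide_eq_side_of_det_one`; `G₁(m) = [m₀₀m₁₀ > 0 ∨ m₀₁m₁₁ > 0 ∨ (m₀₀+m₀₁)(m₁₀+m₁₁) > 0]` is w2's side of the TRIANGLE of `m`); (B2) the
three forms never vanish together when `det C ≠ 0` (`flagSide_key_ne_zero`), hence EDGE REVERSAL `F(S·C) = 1 − F(C)` (`flagSide_S_mul`) and
`F(−C) = F(C)`, `F(kC) = F(C)` (`flagSide_neg`, `flagSide_smul`: the side of the flag `A·φ₀` w.r.t. the generalised edge `B·{∞,0}` is
`F(adj(B)·A)`, automatically `GL₂⁺(ℚ)`-equivariant); (B4) ANCHORS (`exists_flagAnchor`): for every `M` with `det M > 0` there is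
`m ∈ SL₂(ℤ)` with `F(g⁻¹M) = G₁(g⁻¹m)` for ALL `g ∈ SL₂(ℤ)` — the flag `M·φ₀` and the Farey triangle of `m` lie on the same side of every
Farey edge («the triangle containing the flag»; `m = g₀Tⁿ` from the Hermite form `g₀⁻¹M = (u v; 0 w)`, `n = ⌊(u+2v)/2w⌋`).

References: [Manin1972] §1.5; [CremonaAlgorithms1997] §2.2 (M-symbols and Farey neighbours); [Merel1995Homologie] §1.2 (the perturbed
path `0 → z₀ → ∞`, `−½ < Re z₀ < 0`, which is the printed form of choosing a side).
-/

set_option autoImplicit false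

noncomputable section

-- justification: the `Summit.BirchSwinnertonDyer.BirchSwinnertonDyer.…` path repeats a component (route-file convention)
set_option linter.dupNamespace false

open scoped Classical MatrixGroups

open CongruenceSubgroup Matrix.SpecialLinearGroup ModularGroup
open Literature.NumberTheory.EllipticCurves.ModularForms

namespace Summit.BirchSwinnertonDyer.BirchSwinnertonDyer.Theorems.ThetaLayerLambdaCongruenceAtTwo

/-! ## §1. The flag side function in coordinates -/

section Coordinates

/-- **Non-degeneracy (B2).** If `ad − bc ≠ 0` and `ac = 0` then `ad + bc ≠ 0`: the three lexicographic keys `ac, (a+2b)(c+2d), ad+bc` of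
the flag side function never vanish simultaneously (the generic flag lies on no rational geodesic). [folklore] -/
theorem flagSide_key_ne_zero (a b c d : ℤ) (hdet : a * d - b * c ≠ 0) (hac : a * c = 0) : a * d + b * c ≠ 0 := by
  rcases mul_eq_zero.mp hac with rfl | rfl
  · simpa using hdet
  · simpa using hdet

/-- **(B1) On `SL₂(ℤ)` the flag side function is the triangle side function**: for `ad − bc = 1`,
`[lex(ac, (a+2b)(c+2d), ad+bc) > 0] = [ac > 0 ∨ bd > 0 ∨ (a+b)(c+d) > 0]` — the generic point of a Farey triangle lies on the same side of
`{∞, 0}` as the triangle (Farey triangles do not straddle `{∞,0}`: `farey_not_opposite_signs`; four boundary cases `m = ±Tᵇ`, `m = ±(0 ∓1; ±1 d)`).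
[cite: CremonaAlgorithms1997, §2.2] -/
theorem flagSide_eq_side_of_det_one (a b c d : ℤ) (hdet : a * d - b * c = 1) :
    (if (0 < a * c ∨ (a * c = 0 ∧ (0 < (a + 2 * b) * (c + 2 * d) ∨
        ((a + 2 * b) * (c + 2 * d) = 0 ∧ 0 < a * d + b * c)))) then (1 : ℤ) else 0) =
    (if (0 < a * c ∨ 0 < b * d ∨ 0 < (a + b) * (c + d)) then (1 : ℤ) else 0) := by
  rcases lt_trichotomy 0 (a * c) with hac | hac | hac
  · rw [if_pos (Or.inl hac), if_pos (Or.inl hac)]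
  · -- `ac = 0`: `a = 0` (then `bc = −1`) or `c = 0` (then `ad = 1`)
    rcases mul_eq_zero.mp hac.symm with ha | hc
    · subst ha
      have hbc : b * c = -1 := by linarith
      rcases Int.eq_one_or_neg_one_of_mul_eq_neg_one hbc with hb | hb <;> subst hb
      · have hc : c = -1 := by linarith
        subst hc
        by_cases hd : 1 ≤ d
        · rw [if_pos (Or.inr ⟨by ring, Or.inl (by nlinarith)⟩), if_pos (Or.inr (Or.inl (by nlinarith)))]
        · rw [if_neg (by rintro (h | ⟨-, h | ⟨h', h⟩⟩) <;> nlinarith),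
            if_neg (by rintro (h | h | h) <;> nlinarith)]
      · have hc : c = 1 := by linarith
        subst hc
        by_cases hd : d ≤ -1
        · rw [if_pos (Or.inr ⟨by ring, Or.inl (by nlinarith)⟩), if_pos (Or.inr (Or.inl (by nlinarith)))]
        · rw [if_neg (by rintro (h | ⟨-, h | ⟨h', h⟩⟩) <;> nlinarith),
            if_neg (by rintro (h | h | h) <;> nlinarith)]
    · subst hc
      have had : a * d = 1 := by linarith
      rcases Int.eq_one_or_neg_one_of_mul_eq_one had with ha | ha <;> subst ha
      · have hd : d = 1 := by linarith
        subst hd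
        by_cases hb : 0 ≤ b
        · rw [if_pos (Or.inr ⟨by ring, Or.inl (by nlinarith)⟩), if_pos (Or.inr (Or.inr (by nlinarith)))]
        · rw [if_neg (by rintro (h | ⟨-, h | ⟨h', h⟩⟩) <;> nlinarith),
            if_neg (by rintro (h | h | h) <;> nlinarith)]
      · have hd : d = -1 := by linarith
        subst hd
        by_cases hb : b ≤ 0
        · rw [if_pos (Or.inr ⟨by ring, Or.inl (by nlinarith)⟩), if_pos (Or.inr (Or.inr (by nlinarith)))]
        · rw [if_neg (by rintro (h | ⟨-, h | ⟨h', h⟩⟩) <;> nlinarith),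
            if_neg (by rintro (h | h | h) <;> nlinarith)]
  · -- `ac < 0`: the flag is on the negative side, and so is the triangle (Farey pairs do not straddle `{∞,0}`)
    have h1 : ¬ 0 < b * d := fun h ↦ farey_not_opposite_signs a b c d (Or.inl hdet) ⟨hac, h⟩
    have h2 : ¬ 0 < (a + b) * (c + d) := fun h ↦
      farey_not_opposite_signs a (a + b) c (c + d) (Or.inl (by linear_combination hdet)) ⟨hac, h⟩
    rw [if_neg (by rintro (h | ⟨h, -⟩) <;> linarith), if_neg (by rintro (h | h | h) <;> linarith)]


/-- **Sign invariance (B3)**: `F(−C) = F(C)` (all three keys are quadratic). [folklore] -/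
theorem flagSide_neg (a b c d : ℤ) :
    (if (0 < (-a) * (-c) ∨ ((-a) * (-c) = 0 ∧ (0 < (-a + 2 * -b) * (-c + 2 * -d) ∨
        ((-a + 2 * -b) * (-c + 2 * -d) = 0 ∧ 0 < (-a) * (-d) + (-b) * (-c))))) then (1 : ℤ) else 0) =
    (if (0 < a * c ∨ (a * c = 0 ∧ (0 < (a + 2 * b) * (c + 2 * d) ∨
        ((a + 2 * b) * (c + 2 * d) = 0 ∧ 0 < a * d + b * c)))) then (1 : ℤ) else 0) := by
  have e1 : (-a) * (-c) = a * c := by ring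
  have e2 : (-a + 2 * -b) * (-c + 2 * -d) = (a + 2 * b) * (c + 2 * d) := by ring
  have e3 : (-a) * (-d) + (-b) * (-c) = a * d + b * c := by ring
  rw [e1, e2, e3]

/-- **Homogeneity (B3)**: `F(kC) = F(C)` for `k ≠ 0` (the keys scale by `k² > 0`), so `F(adj(B)·A)` is the side of the flag `A·φ₀`
with respect to the generalised edge `B·{∞,0}` for all integer `A, B` of positive determinant. [folklore] -/
theorem flagSide_smul (k a b c d : ℤ) (hk : k ≠ 0) :
    (if (0 < (k * a) * (k * c) ∨ ((k * a) * (k * c) = 0 ∧ (0 < (k * a + 2 * (k * b)) * (k * c + 2 * (k * d)) ∨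
        ((k * a + 2 * (k * b)) * (k * c + 2 * (k * d)) = 0 ∧ 0 < (k * a) * (k * d) + (k * b) * (k * c))))) then (1 : ℤ) else 0) =
    (if (0 < a * c ∨ (a * c = 0 ∧ (0 < (a + 2 * b) * (c + 2 * d) ∨
        ((a + 2 * b) * (c + 2 * d) = 0 ∧ 0 < a * d + b * c)))) then (1 : ℤ) else 0) := by
  have hk2 : 0 < k ^ 2 := by positivity
  have e1 : (k * a) * (k * c) = k ^ 2 * (a * c) := by ring
  have e2 : (k * a + 2 * (k * b)) * (k * c + 2 * (k * d)) = k ^ 2 * ((a + 2 * b) * (c + 2 * d)) := by ring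
  have e3 : (k * a) * (k * d) + (k * b) * (k * c) = k ^ 2 * (a * d + b * c) := by ring
  rw [e1, e2, e3]
  have m1 : ∀ x : ℤ, 0 < k ^ 2 * x ↔ 0 < x := fun x ↦ by
    constructor
    · intro h; by_contra hx; push Not at hx; nlinarith
    · intro h; positivity
  have m2 : ∀ x : ℤ, k ^ 2 * x = 0 ↔ x = 0 := fun x ↦ by
    rw [mul_eq_zero, or_iff_right hk2.ne']
  simp only [m1, m2]

/-- **Edge reversal (B2)**: `F(S·C) = 1 − F(C)` for `det C ≠ 0` (`S·C = (−c, −d; a, b)`: all three keys change sign, and they are never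
simultaneously zero) — a flag lies on exactly one side of a generalised edge. [folklore] -/
theorem flagSide_S_mul (a b c d : ℤ) (hdet : a * d - b * c ≠ 0) :
    (if (0 < (-c) * a ∨ ((-c) * a = 0 ∧ (0 < (-c + 2 * -d) * (a + 2 * b) ∨
        ((-c + 2 * -d) * (a + 2 * b) = 0 ∧ 0 < (-c) * b + (-d) * a)))) then (1 : ℤ) else 0) =
    1 - (if (0 < a * c ∨ (a * c = 0 ∧ (0 < (a + 2 * b) * (c + 2 * d) ∨
        ((a + 2 * b) * (c + 2 * d) = 0 ∧ 0 < a * d + b * c)))) then (1 : ℤ) else 0) := by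
  have e1 : (-c) * a = -(a * c) := by ring
  have e2 : (-c + 2 * -d) * (a + 2 * b) = -((a + 2 * b) * (c + 2 * d)) := by ring
  have e3 : (-c) * b + (-d) * a = -(a * d + b * c) := by ring
  rw [e1, e2, e3]
  rcases lt_trichotomy 0 (a * c) with h1 | h1 | h1
  · rw [if_neg (by rintro (h | ⟨h, -⟩) <;> linarith), if_pos (Or.inl h1)]; norm_num
  · rcases lt_trichotomy 0 ((a + 2 * b) * (c + 2 * d)) with h2 | h2 | h2
    · rw [if_neg (by rintro (h | ⟨-, h | ⟨h, -⟩⟩) <;> linarith), if_pos (Or.inr ⟨h1.symm, Or.inl h2⟩)]; norm_num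
    · have h3 := flagSide_key_ne_zero a b c d hdet h1.symm
      rcases lt_or_gt_of_ne h3 with h3 | h3
      · rw [if_pos (Or.inr ⟨by linarith, Or.inr ⟨by linarith, by linarith⟩⟩),
          if_neg (by rintro (h | ⟨-, h | ⟨-, h⟩⟩) <;> linarith)]; norm_num
      · rw [if_neg (by rintro (h | ⟨-, h | ⟨-, h⟩⟩) <;> linarith),
          if_pos (Or.inr ⟨h1.symm, Or.inr ⟨h2.symm, h3⟩⟩)]; norm_num
    · rw [if_pos (Or.inr ⟨by linarith, Or.inl (by linarith)⟩), if_neg (by rintro (h | ⟨-, h | ⟨h, -⟩⟩) <;> linarith)]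
      norm_num
  · rw [if_pos (Or.inl (by linarith)), if_neg (by rintro (h | ⟨h, -⟩) <;> linarith)]; norm_num

/-- **(B4a) The normalised anchor.** For `(a b; c d) ∈ SL₂(ℤ)` and an upper-triangular `H = (u t; 0 w)` with `u, w > 0` and
`0 ≤ u + 2t < 2w` (the flag `H·φ₀` sits at `∞` with foot in `[½·0⁺… )`, i.e. inside the base triangle `{∞,0,1}`):
`F((a b; c d)·H) = G₁(a b; c d)` — the flag `gH·φ₀` and the triangle of `g` are on the same side of `{∞,0}` for every `g`.
(Case analysis: `ac ≠ 0` by Farey non-straddling; `ac = 0` the four families `±Tᵇ`, `±(0 ∓1; ±1 d)`.) [cite: CremonaAlgorithms1997, §2.2] -/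
theorem flagSide_mul_upper_eq_side (a b c d u t w : ℤ) (hdet : a * d - b * c = 1) (hu : 0 < u) (hw : 0 < w)
    (h0 : 0 ≤ u + 2 * t) (h2 : u + 2 * t < 2 * w) :
    (if (0 < (a * u) * (c * u) ∨ ((a * u) * (c * u) = 0 ∧ (0 < (a * u + 2 * (a * t + b * w)) * (c * u + 2 * (c * t + d * w)) ∨
        ((a * u + 2 * (a * t + b * w)) * (c * u + 2 * (c * t + d * w)) = 0 ∧
          0 < (a * u) * (c * t + d * w) + (a * t + b * w) * (c * u))))) then (1 : ℤ) else 0) =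
    (if (0 < a * c ∨ 0 < b * d ∨ 0 < (a + b) * (c + d)) then (1 : ℤ) else 0) := by
  have hu2 : 0 < u ^ 2 := by positivity
  have e1 : (a * u) * (c * u) = u ^ 2 * (a * c) := by ring
  rw [e1]
  rcases lt_trichotomy 0 (a * c) with hac | hac | hac
  · rw [if_pos (Or.inl (by positivity)), if_pos (Or.inl hac)]
  · rcases mul_eq_zero.mp hac.symm with ha | hc
    · subst ha
      have hbc : b * c = -1 := by linarith
      rcases Int.eq_one_or_neg_one_of_mul_eq_neg_one hbc with hb | hb <;> subst hb
      · have hc : c = -1 := by linarith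
        subst hc
        have eK2 : (0 * u + 2 * (0 * t + 1 * w)) * (-1 * u + 2 * (-1 * t + d * w)) = 2 * w * (2 * (d * w) - u - 2 * t) := by ring
        have eK3 : 0 * u * (-1 * t + d * w) + (0 * t + 1 * w) * (-1 * u) = -(u * w) := by ring
        have huw : 0 < u * w := mul_pos hu hw
        rw [eK2, eK3]
        by_cases hd : 1 ≤ d
        · have hx : 0 < 2 * (d * w) - u - 2 * t := by nlinarith
          rw [if_pos (Or.inr ⟨by ring, Or.inl (by positivity)⟩), if_pos (Or.inr (Or.inl (by linarith)))]
        · have hx : 2 * (d * w) - u - 2 * t ≤ 0 := by nlinarith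
          rw [if_neg (by rintro (h | ⟨-, h | ⟨-, h⟩⟩) <;> nlinarith), if_neg (by rintro (h | h | h) <;> nlinarith)]
      · have hc : c = 1 := by linarith
        subst hc
        have eK2 : (0 * u + 2 * (0 * t + -1 * w)) * (1 * u + 2 * (1 * t + d * w)) = -(2 * w * (u + 2 * t + 2 * (d * w))) := by ring
        have eK3 : 0 * u * (1 * t + d * w) + (0 * t + -1 * w) * (1 * u) = -(u * w) := by ring
        have huw : 0 < u * w := mul_pos hu hw
        rw [eK2, eK3]
        by_cases hd : d ≤ -1
        · have hx : u + 2 * t + 2 * (d * w) < 0 := by nlinarith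
          have hx' : 0 < -(2 * w * (u + 2 * t + 2 * (d * w))) := by nlinarith
          rw [if_pos (Or.inr ⟨by ring, Or.inl hx'⟩), if_pos (Or.inr (Or.inl (by linarith)))]
        · have hx : 0 ≤ u + 2 * t + 2 * (d * w) := by nlinarith
          rw [if_neg (by rintro (h | ⟨-, h | ⟨-, h⟩⟩) <;> nlinarith), if_neg (by rintro (h | h | h) <;> nlinarith)]
    · subst hc
      have had : a * d = 1 := by linarith
      rcases Int.eq_one_or_neg_one_of_mul_eq_one had with ha | ha <;> subst ha
      · have hd : d = 1 := by linarith
        subst hd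
        have eK2 : (1 * u + 2 * (1 * t + b * w)) * (0 * u + 2 * (0 * t + 1 * w)) = 2 * w * (u + 2 * t + 2 * (b * w)) := by ring
        have eK3 : 1 * u * (0 * t + 1 * w) + (1 * t + b * w) * (0 * u) = u * w := by ring
        have huw : 0 < u * w := mul_pos hu hw
        rw [eK2, eK3]
        by_cases hb : 0 ≤ b
        · have hbw : 0 ≤ b * w := by nlinarith
          rcases (show 0 ≤ u + 2 * t + 2 * (b * w) by linarith).lt_or_eq with hlt | heq
          · rw [if_pos (Or.inr ⟨by ring, Or.inl (by positivity)⟩), if_pos (Or.inr (Or.inr (by nlinarith)))]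
          · rw [if_pos (Or.inr ⟨by ring, Or.inr ⟨by rw [← heq, mul_zero], huw⟩⟩), if_pos (Or.inr (Or.inr (by nlinarith)))]
        · have hx : u + 2 * t + 2 * (b * w) < 0 := by nlinarith
          rw [if_neg (by rintro (h | ⟨-, h | ⟨h, -⟩⟩) <;> nlinarith), if_neg (by rintro (h | h | h) <;> nlinarith)]
      · have hd : d = -1 := by linarith
        subst hd
        have eK2 : (-1 * u + 2 * (-1 * t + b * w)) * (0 * u + 2 * (0 * t + -1 * w)) = 2 * w * (u + 2 * t - 2 * (b * w)) := by ring
        have eK3 : -1 * u * (0 * t + -1 * w) + (-1 * t + b * w) * (0 * u) = u * w := by ring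
        have huw : 0 < u * w := mul_pos hu hw
        rw [eK2, eK3]
        by_cases hb : b ≤ 0
        · have hbw : b * w ≤ 0 := by nlinarith
          rcases (show 0 ≤ u + 2 * t - 2 * (b * w) by linarith).lt_or_eq with hlt | heq
          · rw [if_pos (Or.inr ⟨by ring, Or.inl (by positivity)⟩), if_pos (Or.inr (Or.inr (by nlinarith)))]
          · rw [if_pos (Or.inr ⟨by ring, Or.inr ⟨by rw [← heq, mul_zero], huw⟩⟩), if_pos (Or.inr (Or.inr (by nlinarith)))]
        · have hx : u + 2 * t - 2 * (b * w) < 0 := by nlinarith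
          rw [if_neg (by rintro (h | ⟨-, h | ⟨h, -⟩⟩) <;> nlinarith), if_neg (by rintro (h | h | h) <;> nlinarith)]
  · have h1 : ¬ 0 < b * d := fun h ↦ farey_not_opposite_signs a b c d (Or.inl hdet) ⟨hac, h⟩
    have h3 : ¬ 0 < (a + b) * (c + d) := fun h ↦
      farey_not_opposite_signs a (a + b) c (c + d) (Or.inl (by linear_combination hdet)) ⟨hac, h⟩
    rw [if_neg (by rintro (h | ⟨h, -⟩) <;> nlinarith), if_neg (by rintro (h | h | h) <;> linarith)]

end Coordinates

/-! ## §2. Matrices: the flag side function on `SL₂(ℤ)` and anchors -/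

section Matrices

/-- **(B1) for group elements**: for `m ∈ SL₂(ℤ)` the flag side of `m·φ₀` is w2's triangle side `G₁(m)` of `…DualChainAcyclic`.
[cite: CremonaAlgorithms1997, §2.2] -/
theorem flagSide_coe_eq_side (m : SL(2, ℤ)) :
    (if (0 < m 0 0 * m 1 0 ∨ (m 0 0 * m 1 0 = 0 ∧ (0 < (m 0 0 + 2 * m 0 1) * (m 1 0 + 2 * m 1 1) ∨
        ((m 0 0 + 2 * m 0 1) * (m 1 0 + 2 * m 1 1) = 0 ∧ 0 < m 0 0 * m 1 1 + m 0 1 * m 1 0)))) then (1 : ℤ) else 0) =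
    (if (0 < m 0 0 * m 1 0 ∨ 0 < m 0 1 * m 1 1 ∨ 0 < (m 0 0 + m 0 1) * (m 1 0 + m 1 1)) then (1 : ℤ) else 0) := by
  have hdet : m 0 0 * m 1 1 - m 0 1 * m 1 0 = 1 := by
    have := Matrix.det_fin_two m.1
    rw [m.2] at this
    linear_combination -this
  exact flagSide_eq_side_of_det_one _ _ _ _ hdet

/-- **(B4b) Anchor of an upper-triangular matrix.** For `H = (u v; 0 w)` with `u, w > 0` the flag `H·φ₀` sits at the cusp `∞` with foot
`(u + 2v)/(2w)⁺`, inside the Farey triangle `Tⁿ·{∞,0,1} = {∞, n, n+1}`, `n = ⌊(u+2v)/(2w)⌋`: for every `g ∈ SL₂(ℤ)` the flag side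
`F(g⁻¹H)` equals the triangle side `G₁(g⁻¹Tⁿ)`. [cite: Manin1972, §1.5] -/
theorem exists_flagAnchor_upper (u v w : ℤ) (hu : 0 < u) (hw : 0 < w) :
    ∃ n : ℤ, ∀ g : SL(2, ℤ),
      (if (0 < (((g⁻¹ : SL(2, ℤ)) : Matrix (Fin 2) (Fin 2) ℤ) * !![u, v; 0, w]) 0 0 *
              (((g⁻¹ : SL(2, ℤ)) : Matrix (Fin 2) (Fin 2) ℤ) * !![u, v; 0, w]) 1 0 ∨
          ((((g⁻¹ : SL(2, ℤ)) : Matrix (Fin 2) (Fin 2) ℤ) * !![u, v; 0, w]) 0 0 *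
              (((g⁻¹ : SL(2, ℤ)) : Matrix (Fin 2) (Fin 2) ℤ) * !![u, v; 0, w]) 1 0 = 0 ∧
            (0 < ((((g⁻¹ : SL(2, ℤ)) : Matrix (Fin 2) (Fin 2) ℤ) * !![u, v; 0, w]) 0 0 +
                    2 * (((g⁻¹ : SL(2, ℤ)) : Matrix (Fin 2) (Fin 2) ℤ) * !![u, v; 0, w]) 0 1) *
                  ((((g⁻¹ : SL(2, ℤ)) : Matrix (Fin 2) (Fin 2) ℤ) * !![u, v; 0, w]) 1 0 +
                    2 * (((g⁻¹ : SL(2, ℤ)) : Matrix (Fin 2) (Fin 2) ℤ) * !![u, v; 0, w]) 1 1) ∨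
              (((((g⁻¹ : SL(2, ℤ)) : Matrix (Fin 2) (Fin 2) ℤ) * !![u, v; 0, w]) 0 0 +
                    2 * (((g⁻¹ : SL(2, ℤ)) : Matrix (Fin 2) (Fin 2) ℤ) * !![u, v; 0, w]) 0 1) *
                  ((((g⁻¹ : SL(2, ℤ)) : Matrix (Fin 2) (Fin 2) ℤ) * !![u, v; 0, w]) 1 0 +
                    2 * (((g⁻¹ : SL(2, ℤ)) : Matrix (Fin 2) (Fin 2) ℤ) * !![u, v; 0, w]) 1 1) = 0 ∧
                0 < (((g⁻¹ : SL(2, ℤ)) : Matrix (Fin 2) (Fin 2) ℤ) * !![u, v; 0, w]) 0 0 *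
                      (((g⁻¹ : SL(2, ℤ)) : Matrix (Fin 2) (Fin 2) ℤ) * !![u, v; 0, w]) 1 1 +
                    (((g⁻¹ : SL(2, ℤ)) : Matrix (Fin 2) (Fin 2) ℤ) * !![u, v; 0, w]) 0 1 *
                      (((g⁻¹ : SL(2, ℤ)) : Matrix (Fin 2) (Fin 2) ℤ) * !![u, v; 0, w]) 1 0))))
        then (1 : ℤ) else 0) =
      (if (0 < (g⁻¹ * T ^ n) 0 0 * (g⁻¹ * T ^ n) 1 0 ∨ 0 < (g⁻¹ * T ^ n) 0 1 * (g⁻¹ * T ^ n) 1 1 ∨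
          0 < ((g⁻¹ * T ^ n) 0 0 + (g⁻¹ * T ^ n) 0 1) * ((g⁻¹ * T ^ n) 1 0 + (g⁻¹ * T ^ n) 1 1)) then (1 : ℤ) else 0) := by
  set n : ℤ := (u + 2 * v) / (2 * w) with hn
  have hw2 : 0 < 2 * w := by linarith
  have hr0 : 0 ≤ (u + 2 * v) % (2 * w) := Int.emod_nonneg _ hw2.ne'
  have hr2 : (u + 2 * v) % (2 * w) < 2 * w := Int.emod_lt_of_pos _ hw2
  have hdiv : 2 * w * n + (u + 2 * v) % (2 * w) = u + 2 * v := Int.mul_ediv_add_emod _ _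
  refine ⟨n, fun g ↦ ?_⟩
  set Y : SL(2, ℤ) := g⁻¹ * T ^ n with hY
  have hprod : ((g⁻¹ : SL(2, ℤ)) : Matrix (Fin 2) (Fin 2) ℤ) * !![u, v; 0, w] =
      (Y : Matrix (Fin 2) (Fin 2) ℤ) * !![u, v - n * w; 0, w] := by
    rw [hY, Matrix.SpecialLinearGroup.coe_mul, ModularGroup.coe_T_zpow, Matrix.mul_assoc]
    congr 1
    ext i j
    fin_cases i <;> fin_cases j <;> simp [Matrix.mul_apply, Fin.sum_univ_two]
  have e00 : ((Y : Matrix (Fin 2) (Fin 2) ℤ) * !![u, v - n * w; 0, w]) 0 0 = Y 0 0 * u := by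
    simp [Matrix.mul_apply, Fin.sum_univ_two]
  have e01 : ((Y : Matrix (Fin 2) (Fin 2) ℤ) * !![u, v - n * w; 0, w]) 0 1 = Y 0 0 * (v - n * w) + Y 0 1 * w := by
    simp [Matrix.mul_apply, Fin.sum_univ_two]
  have e10 : ((Y : Matrix (Fin 2) (Fin 2) ℤ) * !![u, v - n * w; 0, w]) 1 0 = Y 1 0 * u := by
    simp [Matrix.mul_apply, Fin.sum_univ_two]
  have e11 : ((Y : Matrix (Fin 2) (Fin 2) ℤ) * !![u, v - n * w; 0, w]) 1 1 = Y 1 0 * (v - n * w) + Y 1 1 * w := by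
    simp [Matrix.mul_apply, Fin.sum_univ_two]
  have hdetY : Y 0 0 * Y 1 1 - Y 0 1 * Y 1 0 = 1 := by
    have := Matrix.det_fin_two Y.1
    rw [Y.2] at this
    linear_combination -this
  rw [hprod, e00, e01, e10, e11]
  exact flagSide_mul_upper_eq_side (Y 0 0) (Y 0 1) (Y 1 0) (Y 1 1) u (v - n * w) w hdetY hu hw (by linarith) (by linarith)

/-- **(B4) Anchor existence.** For every integer matrix `M` with `det M > 0` there is `m ∈ SL₂(ℤ)` such that for ALL `g ∈ SL₂(ℤ)` the
flag side `F(g⁻¹M)` (flag `M·φ₀` w.r.t. the Farey edge of `g`) equals the triangle side `G₁(g⁻¹m)` (Farey triangle of `m` w.r.t. the same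
edge): «the Farey triangle containing the flag `M·φ₀`». Hermite step `g₀⁻¹M = (k ∗; 0 ∗)`, `k = gcd(M₀₀, M₁₀)` (Bezout), then (B4b).
[cite: Manin1972, §1.5] [cite: CremonaAlgorithms1997, §2.2] -/
theorem exists_flagAnchor (M : Matrix (Fin 2) (Fin 2) ℤ) (hM : 0 < M.det) :
    ∃ m : SL(2, ℤ), ∀ g : SL(2, ℤ),
      (if (0 < (((g⁻¹ : SL(2, ℤ)) : Matrix (Fin 2) (Fin 2) ℤ) * M) 0 0 * (((g⁻¹ : SL(2, ℤ)) : Matrix (Fin 2) (Fin 2) ℤ) * M) 1 0 ∨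
          ((((g⁻¹ : SL(2, ℤ)) : Matrix (Fin 2) (Fin 2) ℤ) * M) 0 0 * (((g⁻¹ : SL(2, ℤ)) : Matrix (Fin 2) (Fin 2) ℤ) * M) 1 0 = 0 ∧
            (0 < ((((g⁻¹ : SL(2, ℤ)) : Matrix (Fin 2) (Fin 2) ℤ) * M) 0 0 + 2 * (((g⁻¹ : SL(2, ℤ)) : Matrix (Fin 2) (Fin 2) ℤ) * M) 0 1) *
                  ((((g⁻¹ : SL(2, ℤ)) : Matrix (Fin 2) (Fin 2) ℤ) * M) 1 0 + 2 * (((g⁻¹ : SL(2, ℤ)) : Matrix (Fin 2) (Fin 2) ℤ) * M) 1 1) ∨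
              (((((g⁻¹ : SL(2, ℤ)) : Matrix (Fin 2) (Fin 2) ℤ) * M) 0 0 + 2 * (((g⁻¹ : SL(2, ℤ)) : Matrix (Fin 2) (Fin 2) ℤ) * M) 0 1) *
                  ((((g⁻¹ : SL(2, ℤ)) : Matrix (Fin 2) (Fin 2) ℤ) * M) 1 0 + 2 * (((g⁻¹ : SL(2, ℤ)) : Matrix (Fin 2) (Fin 2) ℤ) * M) 1 1) = 0 ∧
                0 < (((g⁻¹ : SL(2, ℤ)) : Matrix (Fin 2) (Fin 2) ℤ) * M) 0 0 * (((g⁻¹ : SL(2, ℤ)) : Matrix (Fin 2) (Fin 2) ℤ) * M) 1 1 +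
                    (((g⁻¹ : SL(2, ℤ)) : Matrix (Fin 2) (Fin 2) ℤ) * M) 0 1 * (((g⁻¹ : SL(2, ℤ)) : Matrix (Fin 2) (Fin 2) ℤ) * M) 1 0))))
        then (1 : ℤ) else 0) =
      (if (0 < (g⁻¹ * m) 0 0 * (g⁻¹ * m) 1 0 ∨ 0 < (g⁻¹ * m) 0 1 * (g⁻¹ * m) 1 1 ∨
          0 < ((g⁻¹ * m) 0 0 + (g⁻¹ * m) 0 1) * ((g⁻¹ * m) 1 0 + (g⁻¹ * m) 1 1)) then (1 : ℤ) else 0) := by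
  -- Bezout / Hermite step on the first column `(M₀₀, M₁₀)`
  have hdetM : M.det = M 0 0 * M 1 1 - M 0 1 * M 1 0 := by rw [Matrix.det_fin_two]
  have hk0 : (Int.gcd (M 0 0) (M 1 0) : ℤ) ≠ 0 := by
    intro h
    have h' : Int.gcd (M 0 0) (M 1 0) = 0 := by exact_mod_cast h
    rw [Int.gcd_eq_zero_iff] at h'
    rw [hdetM, h'.1, h'.2] at hM
    simp at hM
  have hkpos : 0 < (Int.gcd (M 0 0) (M 1 0) : ℤ) := lt_of_le_of_ne (by positivity) (Ne.symm hk0)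
  obtain ⟨a', ha'⟩ := Int.gcd_dvd_left (M 0 0) (M 1 0)
  obtain ⟨c', hc'⟩ := Int.gcd_dvd_right (M 0 0) (M 1 0)
  set k : ℤ := (Int.gcd (M 0 0) (M 1 0) : ℤ) with hk
  set A : ℤ := Int.gcdA (M 0 0) (M 1 0) with hA
  set B : ℤ := Int.gcdB (M 0 0) (M 1 0) with hB
  have hbez : k = M 0 0 * A + M 1 0 * B := Int.gcd_eq_gcd_ab (M 0 0) (M 1 0)
  have h1 : a' * A + c' * B = 1 := by
    have h : k * (a' * A + c' * B) = k * 1 := by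
      rw [mul_one]
      calc k * (a' * A + c' * B) = (k * a') * A + (k * c') * B := by ring
        _ = M 0 0 * A + M 1 0 * B := by rw [← ha', ← hc']
        _ = k := hbez.symm
    exact mul_left_cancel₀ hk0 h
  let g₀ : SL(2, ℤ) := ⟨!![a', -B; c', A], by rw [Matrix.det_fin_two_of]; linear_combination h1⟩
  have hg₀coe : (g₀ : Matrix (Fin 2) (Fin 2) ℤ) = !![a', -B; c', A] := rfl
  have hg₀inv : ((g₀⁻¹ : SL(2, ℤ)) : Matrix (Fin 2) (Fin 2) ℤ) = !![A, B; -c', a'] := by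
    rw [Matrix.SpecialLinearGroup.coe_inv, hg₀coe, Matrix.adjugate_fin_two_of, neg_neg]
  -- `H = g₀⁻¹ M` is upper triangular with positive diagonal
  set H : Matrix (Fin 2) (Fin 2) ℤ := ((g₀⁻¹ : SL(2, ℤ)) : Matrix (Fin 2) (Fin 2) ℤ) * M with hH
  have H00 : H 0 0 = k := by
    have e : H 0 0 = A * M 0 0 + B * M 1 0 := by
      rw [hH, hg₀inv]; simp [Matrix.mul_apply, Fin.sum_univ_two]
    rw [e, hbez]; ring
  have H10 : H 1 0 = 0 := by
    have e : H 1 0 = -c' * M 0 0 + a' * M 1 0 := by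
      rw [hH, hg₀inv]; simp [Matrix.mul_apply, Fin.sum_univ_two]
    rw [e, ha', hc']; ring
  have hdetH : H.det = M.det := by
    rw [hH, Matrix.det_mul, Matrix.SpecialLinearGroup.det_coe, one_mul]
  have H11 : 0 < H 1 1 := by
    have h : H 0 0 * H 1 1 - H 0 1 * H 1 0 = M.det := by rw [← Matrix.det_fin_two, hdetH]
    rw [H00, H10, mul_zero, sub_zero] at h
    rcases lt_trichotomy 0 (H 1 1) with hlt | heq | hgt
    · exact hlt
    · rw [← heq, mul_zero] at h; linarith
    · nlinarith
  have hHeta : H = !![k, H 0 1; 0, H 1 1] := by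
    conv_lhs => rw [Matrix.eta_fin_two H]
    rw [H00, H10]
  obtain ⟨n, hn⟩ := exists_flagAnchor_upper k (H 0 1) (H 1 1) hkpos H11
  refine ⟨g₀ * T ^ n, fun g ↦ ?_⟩
  -- reduce to the upper-triangular case with `g' = g₀⁻¹ g`
  have hM' : ((g⁻¹ : SL(2, ℤ)) : Matrix (Fin 2) (Fin 2) ℤ) * M =
      (((g₀⁻¹ * g)⁻¹ : SL(2, ℤ)) : Matrix (Fin 2) (Fin 2) ℤ) * !![k, H 0 1; 0, H 1 1] := by
    rw [← hHeta, hH, ← Matrix.mul_assoc, ← Matrix.SpecialLinearGroup.coe_mul, mul_inv_rev, inv_inv, mul_assoc,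
      mul_inv_cancel, mul_one]
  have hm' : g⁻¹ * (g₀ * T ^ n) = (g₀⁻¹ * g)⁻¹ * T ^ n := by
    rw [mul_inv_rev, inv_inv, mul_assoc]
  rw [hM', hm']
  exact hn (g₀⁻¹ * g)

end Matrices

end Summit.BirchSwinnertonDyer.BirchSwinnertonDyer.Theorems.ThetaLayerLambdaCongruenceAtTwo

end
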